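import Summits.CriticalPhenomena.CardyFormulaZ2.Theorems.CardyMagicRigidityNestingRigidityNeckZ2RingArc
import HarnessLib

/-!
# Crux `NestingRigidity`, line `pinch-resampling` (v4), stub S12: rotated arc cells of the square ring

Crux `Summit.CriticalPhenomena.CardyFormulaZ2.Theses.CardyMagicRigidity.NestingRigidity`
(stmt-CriticalPhenomena-4835), line `pinch-resampling` v4, stub S12 `stub_neckHookupCoarseZ2 : NeckHookupCoarseZ2`.
Sequel of `…NeckZ2RingArc` (arc coordinate `arcPos R d ∈ [0, 8R)` of the ring `{|d|_∞ = R}`, inverse `arcPt`),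
second geometric brick of the summation of the necklace bound `ZNodeAbsBoundChainA` (amended plan in the module
docstring of `…NestingRigidityGapEntropy`, worker W6a).  The skeleton of a necklace records the occupied CELLS of the
ring at resolution `ℓ`, in the arc coordinate ROTATED by a cut `c ∈ [0, 8R)` placed inside a largest empty gap (so
that the line gaps of `…GapHierarchy` under-estimate the cyclic ones); here is the dictionary between rotated cells
and sup-norm geometry, all in linear integer arithmetic (no `%` by a variable in the statements that matter):

* `NeckCoarseZ2.rotArc R c d` — arc position measured from the cut (`= a - c` or `a - c + 8R`), in `[0, 8R)`
  (`rotArc_nonneg`, `rotArc_lt`); rotation preserves the cyclic distance, whence `zNorm_sub_le_abs_rotArc_sub`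
  (`|d - d'|_∞ ≤ |ã - ã'|`) and `min_rotArc_le_two_mul_zNorm_sub` (`min (|ã - ã'|, 8R - |ã - ã'|) ≤ 2 |d - d'|_∞`).
* `NeckCoarseZ2.rotCell R c ℓ d = ⌊ã / ℓ⌋` — the rotated cell; `zNorm_sub_lt_of_rotCell`: two ring points whose
  rotated cells differ by `Δ` are at sup distance `< (Δ + 1) ℓ` (sup-diameter of a node `≤` its line span, in cells);
  `le_two_mul_zNorm_sub_of_rotCell`: conversely `min (ℓ Δ - ℓ + 1, 8R - ℓ Δ - ℓ + 1) ≤ 2 |d - d'|_∞` (cells at line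
  distance `≥ G` from a node, and not across the cut gap, are at sup distance `≳ G ℓ / 2`: node annuli of outer
  radius `≍ G ℓ / 8` are free of foreign locales and crossed by the clusters reaching them).
* `NeckCoarseZ2.rotCellPt R c ℓ t` — a ring point in the rotated cell `t` (`rotArc_rotCellPt : ã = t ℓ`,
  `rotCell_rotCellPt`, `zNorm_rotCellPt`), the centre of node annuli and arm annuli computed from the skeleton alone;
  `zNorm_rotCellPt_sub_lt`: it is within sup distance `< (|t - T̃(d)| + 1) ℓ` of every ring point `d`.
* Registered anchor `ringCells_dictionary` (the four inequalities packaged).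
-/

noncomputable section

namespace Summit.CriticalPhenomena.CardyFormulaZ2.Cruxes.NestingRigidity.PinchResampling

open Literature.Probability.Percolation Literature.Probability.LatticeModels
open ZPinchLocality

namespace NeckCoarseZ2

/-! ## §1 Rotated arc positions -/

/-- **Rotated arc position**: the arc coordinate measured clockwise from the cut `c`. -/
def rotArc (R c : ℤ) (d : Site 2) : ℤ :=
  if c ≤ arcPos R d then arcPos R d - c else arcPos R d - c + 8 * R

variable {R c : ℤ} {d d' : Site 2}

/-- The rotated arc position is nonnegative (cut in `[0, 8R)`). -/
theorem rotArc_nonneg (hc' : c < 8 * R) (hd : zNorm d = R) : 0 ≤ rotArc R c d := by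
  have h0 := arcPos_nonneg hd
  unfold rotArc
  split_ifs <;> omega

/-- The rotated arc position is `< 8R` (cut in `[0, 8R)`, `R ≥ 1`). -/
theorem rotArc_lt (hR : 1 ≤ R) (hc : 0 ≤ c) (hd : zNorm d = R) : rotArc R c d < 8 * R := by
  have h1 := arcPos_lt hR hd
  unfold rotArc
  split_ifs <;> omega

/-- **Sup distance ≤ rotated arc distance** (rotation preserves the cyclic arc distance). -/
theorem zNorm_sub_le_abs_rotArc_sub (hR : 1 ≤ R) (hd : zNorm d = R) (hd' : zNorm d' = R) :
    zNorm (d - d') ≤ |rotArc R c d - rotArc R c d'| := by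
  have h1 := zNorm_sub_le_arcDist hd hd'
  have h2 := zNorm_sub_le_arcDist' hd hd'
  have ha0 := arcPos_nonneg hd
  have ha1 := arcPos_lt hR hd
  have hb0 := arcPos_nonneg hd'
  have hb1 := arcPos_lt hR hd'
  rw [abs_eq_max_neg] at h1 h2 ⊢
  unfold rotArc
  split_ifs <;> omega

/-- **Rotated cyclic arc distance ≤ twice the sup distance.** -/
theorem min_rotArc_le_two_mul_zNorm_sub (hR : 1 ≤ R) (hd : zNorm d = R) (hd' : zNorm d' = R) :
    min |rotArc R c d - rotArc R c d'| (8 * R - |rotArc R c d - rotArc R c d'|) ≤ 2 * zNorm (d - d') := by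
  have h := arcDist_le_two_mul_zNorm_sub hd hd'
  have ha0 := arcPos_nonneg hd
  have ha1 := arcPos_lt hR hd
  have hb0 := arcPos_nonneg hd'
  have hb1 := arcPos_lt hR hd'
  rw [abs_eq_max_neg] at h ⊢
  unfold rotArc
  split_ifs <;> omega

/-! ## §2 Rotated cells at resolution `ℓ` -/

/-- **Rotated cell** of a ring point at resolution `ℓ`: `⌊rotArc / ℓ⌋`. -/
def rotCell (R c ℓ : ℤ) (d : Site 2) : ℤ := rotArc R c d / ℓ

variable {ℓ : ℤ}

/-- The rotated arc position lies in its cell: `ℓ T̃ ≤ ã < ℓ T̃ + ℓ`. -/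
theorem rotCell_mul_le (hℓ : 0 < ℓ) (d : Site 2) :
    ℓ * rotCell R c ℓ d ≤ rotArc R c d ∧ rotArc R c d < ℓ * rotCell R c ℓ d + ℓ := by
  have h := Int.mul_ediv_add_emod (rotArc R c d) ℓ
  have h0 := Int.emod_nonneg (rotArc R c d) hℓ.ne'
  have h1 := Int.emod_lt_of_pos (rotArc R c d) hℓ
  unfold rotCell
  constructor <;> omega

/-- The rotated cell is nonnegative. -/
theorem rotCell_nonneg (hℓ : 0 < ℓ) (hc' : c < 8 * R) (hd : zNorm d = R) : 0 ≤ rotCell R c ℓ d :=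
  Int.ediv_nonneg (rotArc_nonneg hc' hd) hℓ.le

/-- The rotated cell is `< N` as soon as `8R ≤ N ℓ`. -/
theorem rotCell_lt (hℓ : 0 < ℓ) (hR : 1 ≤ R) (hc : 0 ≤ c) (hd : zNorm d = R) {N : ℤ} (hN : 8 * R ≤ N * ℓ) :
    rotCell R c ℓ d < N := by
  have h := (rotCell_mul_le hℓ d (R := R) (c := c)).1
  have h' := rotArc_lt hR hc hd
  by_contra hcon
  have hcon' : N ≤ rotCell R c ℓ d := le_of_not_gt hcon
  have : N * ℓ ≤ ℓ * rotCell R c ℓ d := by nlinarith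
  omega

/-- **Two ring points whose rotated cells differ by `Δ` are at sup distance `< (Δ + 1) ℓ`.** -/
theorem zNorm_sub_lt_of_rotCell (hℓ : 0 < ℓ) (hR : 1 ≤ R) (hd : zNorm d = R) (hd' : zNorm d' = R) :
    zNorm (d - d') < (|rotCell R c ℓ d - rotCell R c ℓ d'| + 1) * ℓ := by
  have h := zNorm_sub_le_abs_rotArc_sub hR hd hd' (c := c)
  obtain ⟨h1, h2⟩ := rotCell_mul_le hℓ d (R := R) (c := c)
  obtain ⟨h1', h2'⟩ := rotCell_mul_le hℓ d' (R := R) (c := c)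
  set T := rotCell R c ℓ d
  set T' := rotCell R c ℓ d'
  -- `|ã - ã'| < ℓ |T - T'| + ℓ`
  have key : |rotArc R c d - rotArc R c d'| < (|T - T'| + 1) * ℓ := by
    rw [abs_lt]
    constructor
    · have : -(|T - T'|) * ℓ ≤ (T - T') * ℓ :=
        mul_le_mul_of_nonneg_right (neg_abs_le _) hℓ.le
      nlinarith
    · have : (T - T') * ℓ ≤ |T - T'| * ℓ := mul_le_mul_of_nonneg_right (le_abs_self _) hℓ.le
      nlinarith
  exact h.trans_lt key

/-- **Conversely**: `min (ℓ Δ - ℓ + 1) (8R - ℓ Δ - ℓ + 1) ≤ 2 |d - d'|_∞`, `Δ` the difference of the rotated cells. -/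
theorem le_two_mul_zNorm_sub_of_rotCell (hℓ : 0 < ℓ) (hR : 1 ≤ R) (hd : zNorm d = R) (hd' : zNorm d' = R) :
    min (ℓ * |rotCell R c ℓ d - rotCell R c ℓ d'| - ℓ + 1)
      (8 * R - ℓ * |rotCell R c ℓ d - rotCell R c ℓ d'| - ℓ + 1) ≤ 2 * zNorm (d - d') := by
  have h := min_rotArc_le_two_mul_zNorm_sub hR hd hd' (c := c)
  obtain ⟨h1, h2⟩ := rotCell_mul_le hℓ d (R := R) (c := c)
  obtain ⟨h1', h2'⟩ := rotCell_mul_le hℓ d' (R := R) (c := c)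
  set T := rotCell R c ℓ d
  set T' := rotCell R c ℓ d'
  set A := rotArc R c d
  set A' := rotArc R c d'
  -- `ℓ |T - T'| - ℓ < |A - A'| < ℓ |T - T'| + ℓ`
  have hlo : ℓ * |T - T'| - ℓ < |A - A'| := by
    rcases le_total T T' with hTT | hTT
    · rw [abs_of_nonpos (sub_nonpos.2 hTT)]
      have : ℓ * (T' - T) - ℓ < A' - A := by nlinarith
      have h3 : A' - A ≤ |A - A'| := by rw [abs_sub_comm]; exact le_abs_self _
      linarith
    · rw [abs_of_nonneg (sub_nonneg.2 hTT)]
      have : ℓ * (T - T') - ℓ < A - A' := by nlinarith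
      have h3 : A - A' ≤ |A - A'| := le_abs_self _
      linarith
  have hhi : |A - A'| < ℓ * |T - T'| + ℓ := by
    rw [abs_lt]
    constructor
    · have : -(ℓ * |T - T'|) ≤ ℓ * (T - T') := by
        have := mul_le_mul_of_nonneg_left (neg_abs_le (T - T')) hℓ.le
        linarith
      nlinarith
    · have : ℓ * (T - T') ≤ ℓ * |T - T'| := mul_le_mul_of_nonneg_left (le_abs_self _) hℓ.le
      nlinarith
  have key : min (ℓ * |T - T'| - ℓ + 1) (8 * R - ℓ * |T - T'| - ℓ + 1) ≤ min |A - A'| (8 * R - |A - A'|) := by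
    apply min_le_min <;> omega
  exact key.trans h

/-! ## §3 Ring points of rotated cells -/

/-- **A ring point in the rotated cell `t`**: the point of arc coordinate `t ℓ + c (mod 8R)`. -/
def rotCellPt (R c ℓ t : ℤ) : Site 2 :=
  arcPt R (if t * ℓ + c < 8 * R then t * ℓ + c else t * ℓ + c - 8 * R)

variable {t : ℤ}

/-- The point of the rotated cell `t` lies on the ring (`0 ≤ t`, `t ℓ < 8R`, cut in `[0, 8R)`). -/
theorem zNorm_rotCellPt (hℓ : 0 < ℓ) (hc : 0 ≤ c) (hc' : c < 8 * R) (ht : 0 ≤ t) (ht' : t * ℓ < 8 * R) :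
    zNorm (rotCellPt R c ℓ t) = R := by
  have : 0 ≤ t * ℓ := mul_nonneg ht hℓ.le
  unfold rotCellPt
  split_ifs with h
  · exact zNorm_arcPt (by omega) h
  · exact zNorm_arcPt (by omega) (by omega)

/-- The rotated arc position of the point of the rotated cell `t` is exactly `t ℓ`. -/
theorem rotArc_rotCellPt (hℓ : 0 < ℓ) (hc' : c < 8 * R) (ht : 0 ≤ t) (ht' : t * ℓ < 8 * R) :
    rotArc R c (rotCellPt R c ℓ t) = t * ℓ := by
  have h0 : 0 ≤ t * ℓ := mul_nonneg ht hℓ.le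
  unfold rotArc rotCellPt
  split_ifs with h h' h'
  · rw [arcPos_arcPt h]; ring
  · rw [arcPos_arcPt h] at h'; omega
  · rw [arcPos_arcPt (by omega)] at h'; omega
  · rw [arcPos_arcPt (by omega)]; ring

/-- The rotated cell of the point of the rotated cell `t` is `t`. -/
theorem rotCell_rotCellPt (hℓ : 0 < ℓ) (hc' : c < 8 * R) (ht : 0 ≤ t) (ht' : t * ℓ < 8 * R) :
    rotCell R c ℓ (rotCellPt R c ℓ t) = t := by
  rw [rotCell, rotArc_rotCellPt hℓ hc' ht ht', Int.mul_ediv_cancel _ hℓ.ne']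

/-- **The point of the rotated cell `t` is within sup distance `< (|t - T̃(d)| + 1) ℓ` of every ring point `d`.** -/
theorem zNorm_rotCellPt_sub_lt (hℓ : 0 < ℓ) (hR : 1 ≤ R) (hc : 0 ≤ c) (hc' : c < 8 * R) (ht : 0 ≤ t)
    (ht' : t * ℓ < 8 * R) (hd : zNorm d = R) :
    zNorm (rotCellPt R c ℓ t - d) < (|t - rotCell R c ℓ d| + 1) * ℓ := by
  have h := zNorm_sub_lt_of_rotCell hℓ hR (zNorm_rotCellPt hℓ hc hc' ht ht') hd (c := c)
  rwa [rotCell_rotCellPt hℓ hc' ht ht'] at h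

end NeckCoarseZ2

/-- **Dictionary between rotated ring cells and sup-norm geometry (registered helper, anchor of this module on the
crux item).**  For a cut `c ∈ [0, 8R)`, resolution `ℓ ≥ 1` and ring points `d, d'` (`|d|_∞ = |d'|_∞ = R ≥ 1`) with
rotated cells `T̃, T̃'`: `|d - d'|_∞ < (|T̃ - T̃'| + 1) ℓ`; `min (ℓ |T̃ - T̃'| - ℓ + 1) (8R - ℓ |T̃ - T̃'| - ℓ + 1) ≤
2 |d - d'|_∞`; and for `0 ≤ t`, `t ℓ < 8R` the point `rotCellPt R c ℓ t` is a ring point of rotated cell `t` within sup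
distance `< (|t - T̃| + 1) ℓ` of `d`. -/
theorem ringCells_dictionary : ∀ (R c ℓ : ℤ) (d d' : Site 2), 0 < ℓ → 1 ≤ R → 0 ≤ c → c < 8 * R → zNorm d = R → zNorm d' = R → zNorm (d - d') < (|NeckCoarseZ2.rotCell R c ℓ d - NeckCoarseZ2.rotCell R c ℓ d'| + 1) * ℓ ∧ min (ℓ * |NeckCoarseZ2.rotCell R c ℓ d - NeckCoarseZ2.rotCell R c ℓ d'| - ℓ + 1) (8 * R - ℓ * |NeckCoarseZ2.rotCell R c ℓ d - NeckCoarseZ2.rotCell R c ℓ d'| - ℓ + 1) ≤ 2 * zNorm (d - d') ∧ ∀ t : ℤ, 0 ≤ t → t * ℓ < 8 * R → zNorm (NeckCoarseZ2.rotCellPt R c ℓ t) = R ∧ NeckCoarseZ2.rotCell R c ℓ (NeckCoarseZ2.rotCellPt R c ℓ t) = t ∧ zNorm (NeckCoarseZ2.rotCellPt R c ℓ t - d) < (|t - NeckCoarseZ2.rotCell R c ℓ d| + 1) * ℓ :=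
  fun _ _ _ _ _ hℓ hR hc hc' hd hd' ↦ ⟨NeckCoarseZ2.zNorm_sub_lt_of_rotCell hℓ hR hd hd',
    NeckCoarseZ2.le_two_mul_zNorm_sub_of_rotCell hℓ hR hd hd', fun _ ht ht' ↦
      ⟨NeckCoarseZ2.zNorm_rotCellPt hℓ hc hc' ht ht', NeckCoarseZ2.rotCell_rotCellPt hℓ hc' ht ht',
        NeckCoarseZ2.zNorm_rotCellPt_sub_lt hℓ hR hc hc' ht ht' hd⟩⟩

end Summit.CriticalPhenomena.CardyFormulaZ2.Cruxes.NestingRigidity.PinchResampling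

end
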